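import Summits.ValiantsHypothesis.ValiantsHypothesis.Theorems.SymPencilSingSixClassificationCases

/-!
# Route `SymPencil` — SING-SIX CLASSIFICATION, Theorem A (T6′): every `6`-dimensional linear
# subspace of `Sing Z(per₄)` lies in a cross, has two zero rows / columns, or is an exotic
# one-zero-line family `V_λ`, `V^gr` (ᵀ) — VERBATIM port, part 4/10 (`--supports`
# stmt-ValiantsHypothesis-5674 `SdcSuperquadratic`; rung currency only, nothing here bears on `VP ≠ VNP`)

PORT NOTE (val-width-5674-w2 g0′, helper mode; director-valiant R223 (a)): part 4/10 of a VERBATIM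
port of val-idea-18 g3/g4's SORRY-FREE Theorem A of `Cruxes/SdcSuperquadratic/Lines/
sing_six_classification.lean` rev 2.6 (sha256 dfb5f805c61d14b7…; here: `caseGraph_of` … `basis_expand`).
ALL mathematics and proofs are val-idea-18's (memo `SING-SIX-CLASSIFICATION.md`); the port changes
only the file split, the linear import chain, the namespace, and one-line docstrings on API lemmas.
NOT ported: the `sorry`-stubs of LIST leaves 3–5 and `sixDim_perDir_list` (leaves 3, 4 = landed
`SymPencilPerFourExoticNoSixSquares` / `SymPencilPerFourCrossFilter`; leaf 5 open).
  Cut table: see part 1 (`…Defs`).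
Honest label: Theorem A of a line, not the crux, not the LIST; `27 ≤ sdc(per₄) ≤ 29` unchanged; stmt-5674
open; `VP ≠ VNP` not moved; no summit statement is proved here. [folklore]
-/

noncomputable section
set_option linter.dupNamespace false
set_option linter.unusedVariables false
set_option linter.unusedSectionVars false

namespace Summit.ValiantsHypothesis.ValiantsHypothesis.Theorems.SymPencilSingSixClassification

open MvPolynomial Module Literature.Computability.AlgebraicComplexity
open Literature.Barriers.CriticalPhenomena.Haruspicy (fin4_cases)
variable {K : Type*} [Field K]

/-- **§3.6 (iii) GRAPH KERNEL PLANE — PROVED** (rev 2.3; was `stub_caseGraph`): section `g` of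
`row_{ρ1}`; the generators `(0;0;v;e·σv)` (`v ∈ span(e_j,e_c)`) of `K_r`; the `t¹`-coefficient of
`Sing3` along `g u ± k_v` (char `0`) is the hypothesis of `GraphAbsorb`, which makes `g u` itself
satisfy the graph conditions; absorption; then `V^gr` with `γ 0 = j`, `γ 1 = c`, `c₀ = e`. -/
theorem caseGraph_of [CharZero K] (hGA : GraphAbsorb K) : CaseGraph K := by
  intro W ρ j c e hN hρ htop hjc he hK
  obtain ⟨hS, h6, h0⟩ := hN
  have h12 : ρ 1 ≠ ρ 2 := fun h => by simpa using ρ.injective h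
  have h13 : ρ 1 ≠ ρ 3 := fun h => by simpa using ρ.injective h
  have h23 : ρ 2 ≠ ρ 3 := fun h => by simpa using ρ.injective h
  obtain ⟨g, hsec⟩ := exists_rowSection htop
  have hgW : ∀ u, ((g u : W) : Fin 4 × Fin 4 → K) ∈ W := fun u => (g u).2
  set φ : (Fin 4 → K) →ₗ[K] (Fin 4 → K) := (rowL (K := K) (ρ 2)).comp (W.subtype.comp g) with hφ
  set χ : (Fin 4 → K) →ₗ[K] (Fin 4 → K) := (rowL (K := K) (ρ 3)).comp (W.subtype.comp g) with hχ
  have hφu : ∀ u, φ u = row ((g u : W) : Fin 4 × Fin 4 → K) (ρ 2) := fun u => rfl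
  have hχu : ∀ u, χ u = row ((g u : W) : Fin 4 × Fin 4 → K) (ρ 3) := fun u => rfl
  -- generators of `K_r`: `(0; 0; v; e σ v)` for `v` supported on `{j, c}`
  have hkv : ∀ v : Fin 4 → K, (∀ i, i ≠ j → i ≠ c → v i = 0) →
      (rowAt (ρ 2) v + rowAt (ρ 3) (e • flipAt c v)) ∈ W ∧
        row (rowAt (ρ 2) v + rowAt (ρ 3) (e • flipAt c v)) (ρ 1) = 0 := by
    intro v hv
    refine (hK _).mpr ⟨fun i hi2 hi3 => ?_, fun i hij hic => ⟨?_, ?_⟩, ?_, ?_⟩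
    · rw [row_add, row_rowAt_ne hi2, row_rowAt_ne hi3, add_zero]
    · simp [rowAt_apply_ne h23, hv i hij hic]
    · simp [rowAt_apply_ne h23.symm, flipAt, hic, hv i hij hic]
    · simp [rowAt_apply_ne h23, rowAt_apply_ne h23.symm, flipAt, hjc]
    · simp [rowAt_apply_ne h23, rowAt_apply_ne h23.symm, flipAt]
  -- the `t¹`-coefficient of `Sing3` along `g u ± k_v`
  have hT : ∀ u v : Fin 4 → K, (∀ i, i ≠ j → i ≠ c → v i = 0) → ∀ l,
      T3 u v (χ u) l + e * T3 u (flipAt c v) (φ u) l = 0 := by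
    intro u v hv l
    obtain ⟨hkW, hk1⟩ := hkv v hv
    have hk2 : row (rowAt (ρ 2) v + rowAt (ρ 3) (e • flipAt c v)) (ρ 2) = v := by
      rw [row_add, row_rowAt_self, row_rowAt_ne h23, add_zero]
    have hk3 : row (rowAt (ρ 2) v + rowAt (ρ 3) (e • flipAt c v)) (ρ 3) = e • flipAt c v := by
      rw [row_add, row_rowAt_ne h23.symm, row_rowAt_self, zero_add]
    generalize rowAt (ρ 2) v + rowAt (ρ 3) (e • flipAt c v) = kv at hkW hk1 hk2 hk3
    have e1 := T3_eq_zero_of_sing3 hS (W.add_mem (hgW u) hkW) (ρ 1) (ρ 2) (ρ 3) h12 h13 h23 l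
    have e2 := T3_eq_zero_of_sing3 hS (W.sub_mem (hgW u) hkW) (ρ 1) (ρ 2) (ρ 3) h12 h13 h23 l
    rw [row_add, row_add, row_add, hk1, hk2, hk3, add_zero, hsec u, ← hφu, ← hχu] at e1
    rw [row_sub, row_sub, row_sub, hk1, hk2, hk3, sub_zero, hsec u, ← hφu, ← hχu] at e2
    have h2 : (2 : K) * (T3 u v (χ u) l + e * T3 u (flipAt c v) (φ u) l) = 0 := by
      simp only [T3, Pi.add_apply, Pi.sub_apply, Pi.smul_apply, smul_eq_mul] at e1 e2 ⊢
      linear_combination e1 - e2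
    exact (mul_eq_zero.mp h2).resolve_left two_ne_zero
  have hG : ∀ u, (∀ i, i ≠ j → i ≠ c → φ u i = 0) ∧ χ u = e • flipAt c (φ u) :=
    hGA j c e φ χ hjc he hT
  -- `g u` itself satisfies the graph conditions
  have hGg : ∀ u, GraphCond (ρ 2) (ρ 3) j c e ((g u : W) : Fin 4 × Fin 4 → K) := by
    intro u
    obtain ⟨hφ0, hχe⟩ := hG u
    have hχi : ∀ i, χ u i = e * flipAt c (φ u) i := fun i => by
      rw [hχe, Pi.smul_apply, smul_eq_mul]
    refine ⟨fun i hij hic => ⟨?_, ?_⟩, ?_, ?_⟩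
    · exact hφ0 i hij hic
    · have := hχi i
      rw [flipAt_apply_ne hic, hφ0 i hij hic, mul_zero] at this
      exact this
    · have := hχi j
      rw [flipAt_apply_ne hjc] at this
      exact this
    · have := hχi c
      rw [flipAt_apply_self, mul_neg] at this
      exact this
  -- membership in `W`
  have hW : ∀ x, x ∈ W ↔ (row x 0 = 0 ∧ GraphCond (ρ 2) (ρ 3) j c e x) := by
    intro x
    constructor
    · intro hx
      have hk := (hK (x - (g (row x (ρ 1)) : Fin 4 × Fin 4 → K))).mp
        ⟨W.sub_mem hx (hgW _), by rw [row_sub, hsec, sub_self]⟩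
      have hGx := graphCond_add hk.2 (hGg (row x (ρ 1)))
      rw [sub_add_cancel] at hGx
      exact ⟨h0 x hx, hGx⟩
    · rintro ⟨hx0, hGx⟩
      have hk : x - (g (row x (ρ 1)) : Fin 4 × Fin 4 → K) ∈ W := by
        refine ((hK _).mpr ⟨fun i hi2 hi3 => ?_, graphCond_sub hGx (hGg (row x (ρ 1)))⟩).1
        rcases fin4_of_perm ρ i with rfl | rfl | rfl | rfl
        · rw [hρ, row_sub, hx0, h0 _ (hgW _), sub_zero]
        · rw [row_sub, hsec, sub_self]
        · exact absurd rfl hi2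
        · exact absurd rfl hi3
      have := W.add_mem hk (hgW (row x (ρ 1)))
      rwa [sub_add_cancel] at this
  -- conclusion: `V^gr` with `γ 0 = j`, `γ 1 = c`, `c₀ = e`
  obtain ⟨γ, hγ0, hγ1⟩ := exists_perm_zero_one hjc
  have hγ2j : γ 2 ≠ j := by rw [← hγ0]; exact fun h => by simpa using γ.injective h
  have hγ2c : γ 2 ≠ c := by rw [← hγ1]; exact fun h => by simpa using γ.injective h
  have hγ3j : γ 3 ≠ j := by rw [← hγ0]; exact fun h => by simpa using γ.injective h
  have hγ3c : γ 3 ≠ c := by rw [← hγ1]; exact fun h => by simpa using γ.injective h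
  refine ⟨ρ, γ, e, he, fun x => (hW x).trans (and_congr ?_ ?_)⟩
  · rw [hρ]; exact funext_iff
  · constructor
    · rintro ⟨hz, hj, hc⟩
      exact ⟨(hz _ hγ2j hγ2c).1, (hz _ hγ3j hγ3c).1, (hz _ hγ2j hγ2c).2, (hz _ hγ3j hγ3c).2,
        by rw [hγ0]; exact hj, by rw [hγ1]; exact hc⟩
    · rintro ⟨h22, h23', h32, h33, hj, hc⟩
      rw [hγ0] at hj
      rw [hγ1] at hc
      refine ⟨fun i hij hic => ?_, hj, hc⟩
      rcases fin4_of_perm γ i with rfl | rfl | rfl | rfl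
      · exact absurd hγ0 hij
      · exact absurd hγ1 hic
      · exact ⟨h22, h32⟩
      · exact ⟨h23', h33⟩

/-! #### Helpers for the case `max n_r = 3` (rev 2.3) -/

/-- `u ↦ T3 u v w l` as a linear functional. -/
def T3lin (v w : Fin 4 → K) (l : Fin 4) : (Fin 4 → K) →ₗ[K] K where
  toFun u := T3 u v w l
  map_add' u u' := T3_add₁ u u' v w l
  map_smul' c u := by rw [T3_smul₁, smul_eq_mul, RingHom.id_apply]

/-- Auxiliary: `T3lin_apply` (val-idea-18, SING-SIX classification). [folklore] -/
theorem T3lin_apply (v w : Fin 4 → K) (l : Fin 4) (u : Fin 4 → K) :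
    T3lin v w l u = T3 u v w l := rfl

/-- Auxiliary: `T3_single_self` (val-idea-18, SING-SIX classification). [folklore] -/
theorem T3_single_self (v w : Fin 4 → K) (l : Fin 4) : T3 (Pi.single l 1) v w l = 0 := by
  fin_cases l <;> simp [T3, Fin.succAbove]

/-- Symmetry of the polar matrix: `T3 (e_l, v, w)_m = T3 (e_m, v, w)_l`. -/
theorem T3_single_symm (v w : Fin 4 → K) (l m : Fin 4) :
    T3 (Pi.single l 1) v w m = T3 (Pi.single m 1) v w l := by
  fin_cases l <;> fin_cases m <;> simp [T3, Fin.succAbove]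

/-- **Rank drop.**  If `T3 (a, v, w) = 0` for all `a` in a `3`-dimensional `A ⊆ K⁴`, then already
`T3 (u, v, w) = 0` for all `u`, i.e. `v ⊥ w`: the polar matrix is symmetric with zero diagonal, so a
nonzero entry `(l, m)` makes `A = ker (row l) ∋ e_l`, contradicting the entry `(m, l)`. -/
theorem permOrth_of_T3_on {A : Submodule K (Fin 4 → K)} (hA : finrank K A = 3) {v w : Fin 4 → K}
    (h : ∀ a ∈ A, ∀ l, T3 a v w l = 0) : PermOrth v w := by
  have key : ∀ l m, T3 (Pi.single m 1) v w l = 0 := by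
    intro l m
    by_cases hlm : l = m
    · subst hlm; exact T3_single_self v w l
    by_contra hμ
    have hf : T3lin v w l ≠ 0 := fun hf0 => hμ (by
      have := LinearMap.congr_fun hf0 (Pi.single m 1)
      rwa [T3lin_apply, LinearMap.zero_apply] at this)
    have hAle : A ≤ LinearMap.ker (T3lin v w l) := fun a ha => by
      rw [LinearMap.mem_ker, T3lin_apply]; exact h a ha l
    have hlt : finrank K ↥(LinearMap.ker (T3lin v w l)) < 4 := by
      have := Submodule.finrank_lt (mt LinearMap.ker_eq_top.mp hf)
      simpa using this
    have hEq : A = LinearMap.ker (T3lin v w l) := Submodule.eq_of_le_of_finrank_le hAle (by omega)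
    have hl : (Pi.single l 1 : Fin 4 → K) ∈ A := by
      rw [hEq, LinearMap.mem_ker, T3lin_apply]; exact T3_single_self v w l
    have := h _ hl m
    rw [T3_single_symm] at this
    exact hμ this
  refine permOrth_of_T3 fun u l => ?_
  have hf0 : T3lin v w l = 0 :=
    (Pi.basisFun K (Fin 4)).ext fun m => by
      rw [Pi.basisFun_apply, T3lin_apply, LinearMap.zero_apply]; exact key l m
  have := LinearMap.congr_fun hf0 u
  rwa [T3lin_apply, LinearMap.zero_apply] at this

/-- Rank–nullity for the row map: `dim K_r + n_r = dim W`. -/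
theorem finrank_kerPlane_add (W : Submodule K (Fin 4 × Fin 4 → K)) (r : Fin 4) :
    finrank K ↥(W ⊓ LinearMap.ker (rowL (K := K) r)) + finrank K (W.map (rowL r)) =
      finrank K W := by
  have hrn := LinearMap.finrank_range_add_finrank_ker ((rowL (K := K) r).domRestrict W)
  rw [LinearMap.range_domRestrict, LinearMap.ker_domRestrict] at hrn
  rw [← Submodule.map_comap_subtype, Submodule.finrank_map_subtype_eq]
  omega

/-- **Kernel space of a rank-`3` row is pure.**  If `n_r = 3` (`r = ρ 1`), then `K_r` is
`3`-dimensional, every element is a perm-orthogonal pair of rows `ρ 2, ρ 3` (polarisation + rank drop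
on the hyperplane `A_r`), and `PerpPlanes` forces one of the two rows to vanish on `K_r`. -/
theorem kerPlane_pure_of_three [CharZero K] (hP : PerpPlanes K) {W : Submodule K (Fin 4 × Fin 4 → K)}
    (hS : Sing3 W) (h6 : finrank K W = 6) (h0 : ∀ x ∈ W, row x 0 = 0) (ρ : Equiv.Perm (Fin 4))
    (hρ : ρ 0 = 0) (hn3 : finrank K (W.map (rowL (ρ 1))) = 3) :
    (∀ d ∈ W ⊓ LinearMap.ker (rowL (K := K) (ρ 1)), row d (ρ 2) = 0) ∨
      (∀ d ∈ W ⊓ LinearMap.ker (rowL (K := K) (ρ 1)), row d (ρ 3) = 0) := by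
  have h12 : ρ 1 ≠ ρ 2 := fun h => by simpa using ρ.injective h
  have h13 : ρ 1 ≠ ρ 3 := fun h => by simpa using ρ.injective h
  have h23 : ρ 2 ≠ ρ 3 := fun h => by simpa using ρ.injective h
  have hD3 : finrank K ↥(W ⊓ LinearMap.ker (rowL (K := K) (ρ 1))) = 3 := by
    have := finrank_kerPlane_add W (ρ 1); omega
  have hrows : ∀ d ∈ W ⊓ LinearMap.ker (rowL (K := K) (ρ 1)), ∀ i, i ≠ ρ 2 → i ≠ ρ 3 →
      row d i = 0 := by
    intro d hd i hi2 hi3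
    rw [mem_kerPlane] at hd
    rcases fin4_of_perm ρ i with rfl | rfl | rfl | rfl
    · rw [hρ]; exact h0 d hd.1
    · exact hd.2
    · exact absurd rfl hi2
    · exact absurd rfl hi3
  have hperp : ∀ d ∈ W ⊓ LinearMap.ker (rowL (K := K) (ρ 1)), PermOrth (row d (ρ 2)) (row d (ρ 3)) := by
    intro d hd
    rw [mem_kerPlane] at hd
    refine permOrth_of_T3_on hn3 fun a ha l => ?_
    obtain ⟨x, hx, rfl⟩ := Submodule.mem_map.mp ha
    rw [rowL_apply]
    exact polar hS h12 h13 h23 hx hd.1 hd.2 l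
  rcases hP _ (ρ 2) (ρ 3) h23 hrows (by omega) hperp with hv | hw | ⟨h2, -⟩
  · exact Or.inl hv
  · exact Or.inr hw
  · omega

/-- **§3.7 CASE `max n_r = 3` — PROVED** (rev 2.3; was `stub_caseThree`): with `r = τ 1`, `K_r` is
pure (`kerPlane_pure_of_three`), say row `s` vanishes on it; then `row_t` is injective on `K_r`, so
`n_t = 3` and `K_t` is pure as well (second application, to `τ ∘ (1 3)`); if row `s` vanishes on `K_t`
then `W = K_r ⊕ K_t` has the two zero rows `0, s`; if row `r` vanishes on `K_t` then `K_t ⊆ K_r`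
forces `K_t = 0`, contradicting `dim K_t = 3`.  The case "row `t` vanishes on `K_r`" is the same
with `τ = ρ ∘ (2 3)`. -/
theorem caseThree_of [CharZero K] (hP : PerpPlanes K) : CaseThree K := by
  intro W ρ hN hρ hle3 hn3
  obtain ⟨hS, h6, h0⟩ := hN
  have main : ∀ τ : Equiv.Perm (Fin 4), τ 0 = 0 → finrank K (W.map (rowL (τ 1))) = 3 →
      (∀ d ∈ W ⊓ LinearMap.ker (rowL (K := K) (τ 1)), row d (τ 2) = 0) → TwoZeroRows W := by
    intro τ hτ hn3 hpure
    have t02 : (0 : Fin 4) ≠ τ 2 := by rw [← hτ]; exact fun h => by simpa using τ.injective h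
    have t03 : (0 : Fin 4) ≠ τ 3 := by rw [← hτ]; exact fun h => by simpa using τ.injective h
    have hD3 : finrank K ↥(W ⊓ LinearMap.ker (rowL (K := K) (τ 1))) = 3 := by
      have := finrank_kerPlane_add W (τ 1); omega
    -- on `K_r` only row `τ 3` is alive
    have hDrows : ∀ d ∈ W ⊓ LinearMap.ker (rowL (K := K) (τ 1)), ∀ i, i ≠ τ 3 → row d i = 0 := by
      intro d hd i hi3
      have hd' := mem_kerPlane.mp hd
      rcases fin4_of_perm τ i with rfl | rfl | rfl | rfl
      · rw [hτ]; exact h0 d hd'.1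
      · exact hd'.2
      · exact hpure d hd
      · exact absurd rfl hi3
    have hinj : ∀ d ∈ W ⊓ LinearMap.ker (rowL (K := K) (τ 1)), row d (τ 3) = 0 → d = 0 := by
      intro d hd h3
      funext ⟨i, j⟩
      by_cases hi : i = τ 3
      · subst hi; exact congrFun h3 j
      · exact congrFun (hDrows d hd i hi) j
    -- hence `n_t = 3` and `dim K_t = 3`
    have hnt : finrank K (W.map (rowL (τ 3))) = 3 := by
      have hle := hle3 (τ 3) t03.symm
      have hker : LinearMap.ker ((rowL (K := K) (τ 3)).domRestrict
          (W ⊓ LinearMap.ker (rowL (K := K) (τ 1)))) = ⊥ := by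
        refine LinearMap.ker_eq_bot'.mpr fun d hd => ?_
        apply Subtype.ext
        exact hinj d d.2 (by simpa [rowL_apply] using hd)
      have hrn := LinearMap.finrank_range_add_finrank_ker ((rowL (K := K) (τ 3)).domRestrict
          (W ⊓ LinearMap.ker (rowL (K := K) (τ 1))))
      rw [LinearMap.range_domRestrict, hker, finrank_bot, hD3] at hrn
      have hmono : finrank K ↥((W ⊓ LinearMap.ker (rowL (K := K) (τ 1))).map (rowL (K := K) (τ 3)))
          ≤ finrank K (W.map (rowL (τ 3))) :=
        Submodule.finrank_mono (Submodule.map_mono inf_le_left)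
      omega
    have hDt3 : finrank K ↥(W ⊓ LinearMap.ker (rowL (K := K) (τ 3))) = 3 := by
      have := finrank_kerPlane_add W (τ 3); omega
    -- second application of the kernel-plane lemma, to `τ' = τ ∘ (1 3)`
    have e0 : ((Equiv.swap (1 : Fin 4) 3).trans τ) 0 = 0 := by
      simp [Equiv.swap_apply_of_ne_of_ne, hτ]
    have e1 : ((Equiv.swap (1 : Fin 4) 3).trans τ) 1 = τ 3 := by simp
    have e2 : ((Equiv.swap (1 : Fin 4) 3).trans τ) 2 = τ 2 := by
      simp [Equiv.swap_apply_of_ne_of_ne]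
    have e3 : ((Equiv.swap (1 : Fin 4) 3).trans τ) 3 = τ 1 := by simp
    have hcases := kerPlane_pure_of_three hP hS h6 h0 ((Equiv.swap (1 : Fin 4) 3).trans τ) e0
      (by rw [e1]; exact hnt)
    rw [e1, e2, e3] at hcases
    rcases hcases with hs | hr
    · -- row `τ 2` vanishes on `K_t` too: `W = K_r ⊔ K_t`
      have hinf : W ⊓ LinearMap.ker (rowL (K := K) (τ 1)) ⊓ (W ⊓ LinearMap.ker (rowL (K := K) (τ 3)))
          = ⊥ := by
        rw [eq_bot_iff]
        intro d hd
        rw [Submodule.mem_bot]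
        obtain ⟨hdD, hdDt⟩ := Submodule.mem_inf.mp hd
        exact hinj d hdD (mem_kerPlane.mp hdDt).2
      have hsup : W ⊓ LinearMap.ker (rowL (K := K) (τ 1)) ⊔ (W ⊓ LinearMap.ker (rowL (K := K) (τ 3)))
          = W := by
        refine Submodule.eq_of_le_of_finrank_le (sup_le inf_le_left inf_le_left) ?_
        have := Submodule.finrank_sup_add_finrank_inf_eq
          (W ⊓ LinearMap.ker (rowL (K := K) (τ 1))) (W ⊓ LinearMap.ker (rowL (K := K) (τ 3)))
        rw [hinf, finrank_bot, hD3, hDt3] at this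
        omega
      have hrow : ∀ x ∈ W, row x (τ 2) = 0 := by
        intro x hx
        rw [← hsup, Submodule.mem_sup] at hx
        obtain ⟨d, hd, k, hk, rfl⟩ := hx
        rw [row_add, hpure d hd, hs k hk, add_zero]
      exact ⟨0, τ 2, t02, fun x hx j => ⟨congrFun (h0 x hx) j, congrFun (hrow x hx) j⟩⟩
    · -- row `τ 1` vanishes on `K_t`: then `K_t ⊆ K_r` is zero, contradicting `dim K_t = 3`
      exfalso
      have hbot : W ⊓ LinearMap.ker (rowL (K := K) (τ 3)) = ⊥ := by
        rw [eq_bot_iff]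
        intro k hk
        rw [Submodule.mem_bot]
        have hk' := mem_kerPlane.mp hk
        exact hinj k (mem_kerPlane.mpr ⟨hk'.1, hr k hk⟩) hk'.2
      rw [hbot, finrank_bot] at hDt3
      exact absurd hDt3 (by norm_num)
  rcases kerPlane_pure_of_three hP hS h6 h0 ρ hρ hn3 with h2 | h3
  · exact main ρ hρ hn3 h2
  · have e0 : ((Equiv.swap (2 : Fin 4) 3).trans ρ) 0 = 0 := by
      simp [Equiv.swap_apply_of_ne_of_ne, hρ]
    have e1 : ((Equiv.swap (2 : Fin 4) 3).trans ρ) 1 = ρ 1 := by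
      simp [Equiv.swap_apply_of_ne_of_ne]
    have e2 : ((Equiv.swap (2 : Fin 4) 3).trans ρ) 2 = ρ 3 := by simp
    refine main ((Equiv.swap (2 : Fin 4) 3).trans ρ) e0 (by rw [e1]; exact hn3) ?_
    rw [e1, e2]
    exact h3

/-! #### Coordinate transport and the absorption tools (rev 2.4) -/

/-- `w ↦ w ∘ γ` as a linear map. -/
def compPermL (γ : Equiv.Perm (Fin 4)) : (Fin 4 → K) →ₗ[K] (Fin 4 → K) where
  toFun w := w ∘ γ
  map_add' _ _ := rfl
  map_smul' _ _ := rfl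

/-- Auxiliary: `compPermL_apply` (val-idea-18, SING-SIX classification). [folklore] -/
@[simp] theorem compPermL_apply (γ : Equiv.Perm (Fin 4)) (w : Fin 4 → K) :
    compPermL (K := K) γ w = w ∘ γ := rfl

/-- `T3` is equivariant under a simultaneous permutation of the four coordinates
(column-permutation invariance of the permanent). -/
theorem T3_perm (γ : Equiv.Perm (Fin 4)) (u v w : Fin 4 → K) (l : Fin 4) :
    T3 (u ∘ γ) (v ∘ γ) (w ∘ γ) l = T3 u v w (γ l) := by
  let x : Fin 4 × Fin 4 → K := fun p => ![u, v, w, 0] p.1 p.2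
  let x' : Fin 4 × Fin 4 → K := fun p => x (p.1, γ p.2)
  have h1 : ((Matrix.of fun i j => x (i, j)).submatrix ![0, 1, 2] (γ l).succAbove).permanent =
      T3 u v w (γ l) := permanent_submatrix_eq_T3 x 0 1 2 (γ l)
  have h2 : ((Matrix.of fun i j => x' (i, j)).submatrix ![0, 1, 2] l.succAbove).permanent =
      T3 (u ∘ γ) (v ∘ γ) (w ∘ γ) l := permanent_submatrix_eq_T3 x' 0 1 2 l
  rw [← h1, ← h2]
  have hne : ∀ k, γ (l.succAbove k) ≠ γ l := fun k h => Fin.succAbove_ne l k (γ.injective h)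
  choose π hπ using fun k => Fin.exists_succAbove_eq (hne k)
  have hπi : Function.Injective π := by
    intro a b hab
    have h := hπ a
    rw [hab, hπ b] at h
    exact (Fin.succAbove_right_injective (γ.injective h)).symm
  have hπb : Function.Bijective π := Finite.injective_iff_bijective.mp hπi
  have hM : (Matrix.of fun i j => x' (i, j)).submatrix ![0, 1, 2] l.succAbove =
      ((Matrix.of fun i j => x (i, j)).submatrix ![0, 1, 2] (γ l).succAbove).submatrix id
        (Equiv.ofBijective π hπb) := by
    ext i k
    fin_cases i <;> simp [Matrix.submatrix_apply, x', hπ]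
  rw [hM, Matrix.permanent_permute_rows]

/-- Auxiliary: `lvec_comp_perm` (val-idea-18, SING-SIX classification). [folklore] -/
theorem lvec_comp_perm {j c : Fin 4} {γ : Equiv.Perm (Fin 4)} (hγ0 : γ 0 = j) (hγ1 : γ 1 = c)
    (α β : K) : lvec j c α β ∘ γ = lvec 0 1 α β := by
  funext k
  subst hγ0; subst hγ1
  simp [lvec, Pi.single_apply]

/-- The values of `T3 (u, αe₀ + βe₁, w)`. -/
theorem T3_lvec01 (α β : K) (u w : Fin 4 → K) :
    T3 u (lvec 0 1 α β) w 0 = β * (u 2 * w 3 + u 3 * w 2) ∧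
    T3 u (lvec 0 1 α β) w 1 = α * (u 2 * w 3 + u 3 * w 2) ∧
    T3 u (lvec 0 1 α β) w 2 = (β * u 0 + α * u 1) * w 3 + u 3 * (β * w 0 + α * w 1) ∧
    T3 u (lvec 0 1 α β) w 3 = (β * u 0 + α * u 1) * w 2 + u 2 * (β * w 0 + α * w 1) := by
  refine ⟨?_, ?_, ?_, ?_⟩ <;> simp [T3, Fin.succAbove, lvec] <;> ring

/-- Auxiliary: `basis_expand` (val-idea-18, SING-SIX classification). [folklore] -/
theorem basis_expand (u : Fin 4 → K) :
    u = u 0 • (Pi.single 0 1 : Fin 4 → K) + u 1 • Pi.single 1 1 + u 2 • Pi.single 2 1 +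
      u 3 • Pi.single 3 1 := by
  funext i
  fin_cases i <;> simp

end Summit.ValiantsHypothesis.ValiantsHypothesis.Theorems.SymPencilSingSixClassification

end
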